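import Summits.CriticalPhenomena.PercolationContinuityZ3.Theorems.Transplant.SkelTubeRestrict
import HarnessLib

/-!
# L5.1′/L5.2′ — the window-level layer with an INSTANCE-POLYMORPHIC `DecidableEq V` (lane convention, p3-g4 2026-08-20 19:11:29Z (3)):
# boundary characterisations, level nesting, `LHyp`/Step II for window levels, subbox restriction — restated over a `[DecidableEq V]`
# section binder so that files carrying the node's binder compose without instance bridging

builds on p205010 (kernel theorem, internal audit signed; external expert review pending) — nothing in this file uses p205010.
Lane `prim-bschramm`, seat `prim-bschramm-p1` (gen 7); helper file (`--supports stmt-CriticalPhenomena-4575 --as helper`).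

`SkelTubeLevels` (p231058) / `SkelTubeRestrict` (p231899) were typed classical-only: every `outerBoundary` / `innerBoundary` / `IsSubbox` /
`LHyp` / `Kont` term in their STATEMENTS carries the `Classical.propDecidable` instance of `DecidableEq V`.  The lane's convention for the
generic layer (product convention; ruling p3-g4 19:11:29Z (3)) is a `[DecidableEq V]` SECTION BINDER wherever `Finset V` operations of the
KN layer need it — a consumer holding that binder cannot apply a classical-instance statement without a `Subsingleton.elim` bridge at every
use.  This file is the instance-polymorphic form of exactly the instance-dependent declarations of those two files (the definitions
`winGraph`, `winLevel`, `winLData`, `winRestrict`, `EdgeSupp` and the instance-free lemmas are imported unchanged); namespace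
`Transplant.SkelI`, same base names.  Proofs: verbatim.
* §1 `mem_outerBoundary_win_iff`, `mem_innerBoundary_win_iff`, `winLevel_nest`, `mem_sdiff_of_mem_outerBoundary_winLevel`,
  `mem_winLevel_succ_sdiff_iff`, `not_mem_innerBoundary_win_of_mem_Icc`;
* §2 `lhyp_win`, **`stepII_win`**; §3 `isSubbox_winRestrict`, `isSubbox_winRestrict_lattW`.

[cite: KozmaNitzan2024, §4 Lemma 10, pp. 17–18 (Steps I–II), p. 15 (B⟨R⟩), p. 17 (subbox) — the ℤ^d model]
-/

noncomputable section

open MeasureTheory ProbabilityTheory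
open scoped ENNReal

namespace Summit.CriticalPhenomena.PercolationContinuityZ3.Theorems

namespace Transplant

namespace SkelI

open Literature.Probability.Percolation Literature.Probability.LatticeModels SimpleGraph
open Literature.Barriers.CriticalPhenomena (graphBall graphBall_finite mem_graphBall_self graphBall_mono)
open KNLevels Skel
open scoped Classical

variable {V : Type} [DecidableEq V] {G : SimpleGraph V} [G.LocallyFinite] (Φ : PlanarSkeletonConc G)

/-! ## §1 Boundaries of windows and levels in the window graph -/

/-- **Outer boundary of a window in the window graph** (structural form; instance-polymorphic). [cite: KozmaNitzan2024, §4 p. 15 (∂_ev B)] -/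
theorem mem_outerBoundary_win_iff {w₀ : V} {R : ℕ} {P : Finset (Site 2)} {x : V} :
    x ∈ outerBoundary (winGraph G w₀ R) (Φ.Win w₀ P R) ↔
      x ∈ graphBall G w₀ R ∧ Φ.φ x ∉ P ∧ ∃ y, G.Adj x y ∧ y ∈ graphBall G w₀ R ∧ Φ.φ y ∈ P := by
  rw [mem_outerBoundary_iff]
  constructor
  · rintro ⟨hx, y, hy, hxy⟩
    rw [Φ.mem_Win] at hy
    obtain ⟨hadj, hx1, hy1⟩ := (winGraph_adj G).1 hxy
    exact ⟨hx1, fun h => hx ((Φ.mem_Win).2 ⟨hx1, h⟩), y, hadj, hy1, hy.2⟩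
  · rintro ⟨hx1, hxP, y, hxy, hy1, hyP⟩
    exact ⟨fun h => hxP ((Φ.mem_Win).1 h).2, y, (Φ.mem_Win).2 ⟨hy1, hyP⟩, (winGraph_adj G).2 ⟨hxy, hx1, hy1⟩⟩

/-- **Inner boundary of a window in the window graph** (structural form; instance-polymorphic): MACRO contacts only.
[cite: KozmaNitzan2024, §4 p. 17 (∂_iv D)] -/
theorem mem_innerBoundary_win_iff {w₀ : V} {R : ℕ} {P : Finset (Site 2)} {v : V} :
    v ∈ innerBoundary (winGraph G w₀ R) (Φ.Win w₀ P R) ↔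
      (v ∈ graphBall G w₀ R ∧ Φ.φ v ∈ P) ∧ ∃ y, G.Adj v y ∧ y ∈ graphBall G w₀ R ∧ Φ.φ y ∉ P := by
  rw [mem_innerBoundary_iff, Φ.mem_Win]
  constructor
  · rintro ⟨hv, y, hy, hvy⟩
    obtain ⟨hadj, -, hy1⟩ := (winGraph_adj G).1 hvy
    exact ⟨hv, y, hadj, hy1, fun h => hy ((Φ.mem_Win).2 ⟨hy1, h⟩)⟩
  · rintro ⟨hv, y, hvy, hy1, hyP⟩
    exact ⟨hv, y, fun h => hyP ((Φ.mem_Win).1 h).2, (winGraph_adj G).2 ⟨hvy, hv.1, hy1⟩⟩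

/-- **Level axiom 2** (instance-polymorphic): the outer boundary of `B⟨j⟩` in the window graph lies in `B⟨j+1⟩`.
[cite: KozmaNitzan2024, §4 p. 15 (∂_ev B ⊆ B⟨1⟩)] -/
theorem winLevel_nest (w₀ : V) (R : ℕ) (lo hi : Site 2) (j : ℕ) :
    outerBoundary (winGraph G w₀ R) (winLevel Φ w₀ R lo hi j) ⊆ winLevel Φ w₀ R lo hi (j + 1) := by
  intro x hx
  obtain ⟨hx1, -, y, hxy, -, hyP⟩ := (mem_outerBoundary_win_iff Φ).1 hx
  rw [mem_winLevel_iff]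
  refine ⟨hx1, ?_⟩
  have h := φ_mem_Icc_enlarge_of_adj Φ hyP hxy.symm
  refine Finset.Icc_subset_Icc (fun i => ?_) (fun i => ?_) h <;>
    simp only [Pi.sub_apply, Pi.add_apply, Pi.natCast_apply, Pi.one_apply] <;> push_cast <;> omega

/-- A contact of level `j` lies in the planar annulus `B⟨j+1⟩ ∖ B⟨j⟩` (instance-polymorphic). [cite: KozmaNitzan2024, §4 p. 15 (∂_ev B)] -/
theorem mem_sdiff_of_mem_outerBoundary_winLevel {w₀ : V} {R : ℕ} {lo hi : Site 2} {j : ℕ} {x : V}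
    (hx : x ∈ outerBoundary (winGraph G w₀ R) (winLevel Φ w₀ R lo hi j)) :
    x ∈ winLevel Φ w₀ R lo hi (j + 1) \ winLevel Φ w₀ R lo hi j :=
  Finset.mem_sdiff.2 ⟨winLevel_nest Φ w₀ R lo hi j hx, (mem_outerBoundary_iff.1 hx).1⟩

/-- The planar annulus `B⟨j+1⟩ ∖ B⟨j⟩` in coordinates (instance-polymorphic). [folklore] -/
theorem mem_winLevel_succ_sdiff_iff {w₀ : V} {R : ℕ} {lo hi : Site 2} {j : ℕ} {x : V} :
    x ∈ winLevel Φ w₀ R lo hi (j + 1) \ winLevel Φ w₀ R lo hi j ↔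
      x ∈ graphBall G w₀ R ∧ Φ.φ x ∈ Finset.Icc (lo - ((j + 1 : ℕ) : Site 2)) (hi + ((j + 1 : ℕ) : Site 2)) ∧
        Φ.φ x ∉ Finset.Icc (lo - (j : Site 2)) (hi + (j : Site 2)) := by
  rw [Finset.mem_sdiff, mem_winLevel_iff, mem_winLevel_iff]
  tauto

/-- **Amendment (A), generic form** (instance-polymorphic): a window vertex with `φ` in the shrunk box is not an inner-boundary vertex.
[cite: KozmaNitzan2024, §4 p. 17 (∂_iv D)] -/
theorem not_mem_innerBoundary_win_of_mem_Icc {w₀ : V} {R : ℕ} {lo hi : Site 2} {v : V}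
    (hv : Φ.φ v ∈ Finset.Icc (lo + 1) (hi - 1)) : v ∉ innerBoundary (winGraph G w₀ R) (Φ.Win w₀ (Finset.Icc lo hi) R) := by
  intro h
  obtain ⟨-, y, hvy, -, hyP⟩ := (mem_innerBoundary_win_iff Φ).1 h
  refine hyP ?_
  have h1 := φ_mem_Icc_enlarge_of_adj Φ hv hvy
  refine Finset.Icc_subset_Icc (fun i => ?_) (fun i => ?_) h1 <;>
    simp only [Pi.sub_apply, Pi.add_apply, Pi.one_apply] <;> omega

/-! ## §2 `LHyp` and Step II for window levels -/

/-- **The hypotheses of Lemma 10 for window levels** (instance-polymorphic). [cite: KozmaNitzan2024, §4 Lemma 10 (p. 17)] -/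
theorem lhyp_win (w₀ : V) (R : ℕ) (lo hi : Site 2) {o : V} {Sfin D : Finset V} {Wt : Sym2 V → unitInterval} {p : unitInterval}
    {Rl : ℕ} (hsub : IsSubbox (winGraph G w₀ R) Wt p D) (hfin : FinSupp Wt Sfin) (hDS : D ⊆ Sfin)
    (hencl : winLevel Φ w₀ R lo hi (Rl + 1) ⊆ D) (ho : o ∉ D) (hoS : o ∈ Sfin) :
    LHyp (winLData Φ w₀ R lo hi o Sfin) Wt p D Rl where
  mono := winLevel_monotone Φ w₀ R lo hi
  nest := winLevel_nest Φ w₀ R lo hi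
  sub := hsub
  fin := hfin
  DS := hDS
  encl := hencl
  o_not := ho
  o_mem := hoS

/-- **Kozma–Nitzan's Step II over the window levels of a `PlanarSkeletonConc`** (instance-polymorphic form of `Skel.stepII_win`).
[cite: KozmaNitzan2024, §4 p. 18 (Step II)] -/
theorem stepII_win [Countable V] (w₀ : V) (R : ℕ) (lo hi : Site 2) {o : V} {Sfin D : Finset V}
    {Wt : Sym2 V → unitInterval} {p : unitInterval} {Rl : ℕ}
    (hsub : IsSubbox (winGraph G w₀ R) Wt p D) (hfin : FinSupp Wt Sfin) (hDS : D ⊆ Sfin)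
    (hencl : winLevel Φ w₀ R lo hi (Rl + 1) ⊆ D) (ho : o ∉ D) (hoS : o ∈ Sfin)
    (hp1 : (p : ℝ) < 1) {N j₀ j₁ : ℕ} (hj₁ : j₁ ≤ Rl) {δ : ℝ}
    (hJ : 1 / (1 - (p : ℝ)) ^ (Φ.Δ * N) ≤ δ * ((Finset.Icc j₀ j₁).card : ℝ))
    (hreach : 1 - δ < (prodBernoulli Wt).real (⋃ b ∈ Φ.Win w₀ (Finset.Icc lo hi) R, openConn o b)) :
    ∃ j ∈ Finset.Icc j₀ j₁, 1 - 2 * δ < (prodBernoulli Wt).real {ω | N ≤ ((winLData Φ w₀ R lo hi o Sfin).Kont j ω).card} := by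
  have hL := lhyp_win Φ w₀ R lo hi hsub hfin hDS hencl ho hoS
  rw [← reachB_winLData Φ w₀ R lo hi o Sfin] at hreach
  exact hL.stepII (degree_winGraph_le_Δ Φ w₀ R) hp1 hj₁ hJ hreach

/-! ## §3 Subbox restriction to the window graph -/

/-- **Subbox weightings of `G` restrict to subbox weightings of the window graph** (instance-polymorphic form of
`Skel.isSubbox_winRestrict`). [cite: KozmaNitzan2024, §4 p. 17 (subbox)] -/
theorem isSubbox_winRestrict {w₀ : V} {R : ℕ} {Wt : Sym2 V → unitInterval} {p : unitInterval} {D : Finset V}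
    (h : IsSubbox G Wt p D) (hE : EdgeSupp G Wt) (hD : ∀ v ∈ D, v ∈ graphBall G w₀ R) :
    IsSubbox (winGraph G w₀ R) (winRestrict G w₀ R Wt) p D where
  adj u hu v hv huv := by
    rw [winRestrict_mk, if_pos ⟨hD u hu, hD v hv⟩]
    exact h.adj u hu v hv ((winGraph_adj G).1 huv).1
  nadj u hu v hv hne huv := by
    rw [winRestrict_mk, if_pos ⟨hD u hu, hD v hv⟩]
    exact h.nadj u hu v hv hne fun h' => huv ((winGraph_adj G).2 ⟨h', hD u hu, hD v hv⟩)
  outside v hv hvb x hx := by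
    rw [winRestrict_mk]
    split_ifs with hπ
    · by_contra hne
      have hedge := hE _ hne
      rw [SimpleGraph.mem_edgeSet] at hedge
      apply hvb
      rw [mem_innerBoundary_iff]
      exact ⟨hv, x, hx, (winGraph_adj G).2 ⟨hedge.symm, hπ.2, hπ.1⟩⟩
    · rfl

/-- The graph weighting restricts to a subbox weighting of the window graph on any `D` inside the ball (instance-polymorphic form of
`Skel.isSubbox_winRestrict_lattW`). [cite: KozmaNitzan2024, §4 p. 17 (subbox)] -/
theorem isSubbox_winRestrict_lattW {w₀ : V} {R : ℕ} (p : unitInterval) {D : Finset V} (hD : ∀ v ∈ D, v ∈ graphBall G w₀ R) :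
    IsSubbox (winGraph G w₀ R) (winRestrict G w₀ R (lattW G p)) p D where
  adj u hu v hv huv := by
    rw [winRestrict_mk, if_pos ⟨hD u hu, hD v hv⟩]
    exact lattW_mk_of_adj G p ((winGraph_adj G).1 huv).1
  nadj u hu v hv hne huv := by
    rw [winRestrict_mk, if_pos ⟨hD u hu, hD v hv⟩]
    exact lattW_mk_of_not_adj G p fun h' => huv ((winGraph_adj G).2 ⟨h', hD u hu, hD v hv⟩)
  outside v hv hvb x hx := by
    rw [winRestrict_mk]
    split_ifs with hπ
    · by_cases hadj : G.Adj x v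
      · exfalso
        apply hvb
        rw [mem_innerBoundary_iff]
        exact ⟨hv, x, hx, (winGraph_adj G).2 ⟨hadj.symm, hπ.2, hπ.1⟩⟩
      · exact lattW_mk_of_not_adj G p hadj
    · rfl

end SkelI

end Transplant

end Summit.CriticalPhenomena.PercolationContinuityZ3.Theorems

end
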